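import Summits.HodgeConjecture.HodgeConjecture.Theses.TropicalKugaSatakeCayley
import Summits.HodgeConjecture.HodgeConjecture.Theorems.TropicalKugaSatakeCayleyKSModelExists
import Summits.HodgeConjecture.HodgeConjecture.Theorems.TropicalKugaSatakeCayleyKontsevichTransferKSFlatWeight
import Mathlib

/-!
# Route `TropicalKugaSatakeCayley`, support S5 `CayleyHodgeRankTwo` (stmt-HodgeConjecture-18573) — part A2:
# the Clifford structure of the Kuga–Satake linear family and the complex structure of every member

The explicit rank-7 Kuga–Satake family `B_t = Σ tᵢ ksForm i` (`Literature/…/Tropical/KugaSatakeLinearFamily`)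
is of CLIFFORD TYPE: `ksForm 0 = B₁ = diag(2,4,4,8,4,8,8,16)`, `ksForm (l+1) = B₁(2 + R_l)` with integral
`R_l` satisfying `R_0² = 1`, `R_l² = 2` (`l ≥ 1`), `R_l R_m = −R_m R_l` (tree: `ksClifford_sq`,
`ksClifford_anticomm`). This file draws the consequences used to decide Hodge types on EVERY member
of the family (part A3: a constant form killed by ten explicit derivations at the cusp is of type `(p,p)`
along every Kuga–Satake period map):

* §1 over `ℝ`: `X² = q·1` for `X = Σ_l t_(l+1) R_l`, `q = t₁² + 2t₂² + 2t₃² + 2t₄²` (`tkc_X_sq`);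
  `B_t = B₁(a·1 + X)`, `a = t₀ + 2(t₁+…+t₄)` (`tkc_ksMatrix_eq`); the **inverse formula**
  `B_t · (a·1 − X)B₁⁻¹ = (a² − q)·1` (`tkc_ksMatrix_mul_Q`) with `(a·1 − X)B₁⁻¹` an explicit combination
  of the `C_j = B₁⁻¹ B_j B₁⁻¹` (`tkc_Q_eq_span`); on the positive cone `a² ≠ q` (`tkc_sq_sub_q_ne_zero`:
  otherwise `X = a·1`, and the `R_l` are traceless) so `B_t⁻¹ = Σ_j u_j C_j` (`tkc_ksMatrix_inv`,
  `tkc_ksMatrix_inv_mem_span`) — the Jordan-algebra fact that the cone is closed under `B ↦ B₁ B⁻¹ B₁`;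
* §2 for a Kuga–Satake period map `Φ` of `z = r + it` (`IsKSPeriodMap z Φ`): `Φ(x, y) = (x + Ry) + i Sy`
  with `R = B_r`, `S = B_t` (`tkc_period_apply`), `Φ⁻¹(e^(iθ) Φ w) = cos θ·w + sin θ·Φ⁻¹(iΦw)`
  (`tkc_symm_exp_smul_eq`), and **the complex structure `J_z = Φ⁻¹∘i∘Φ` in real coordinates**:
  `J_z(x, y) = (−Sy − RS⁻¹(x + Ry), S⁻¹(x + Ry))` (`tkc_J_apply`), i.e. `J_z = A_R⁻¹ J_(iS) A_R` with
  `A_R(x,y) = (x + Ry, y)` unipotent and `J_(iS) = −N_S + N'_(S⁻¹)`.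

Theorems only: no definition, no named fact, no sorry. The explicit diagonal inverse `B₁⁻¹` is written
`Matrix.diagonal (d⁻¹)` throughout (no `def`).

## References

* [vanGeemenVerra2003QuaternionicPryms] B. van Geemen, A. Verra, Quaternionic Pryms and Hodge classes,
  Topology 42 (2003), §6.1 (the Clifford/spin structure of so(7)-type eightfolds).
* [LangeBirkenhake1992] H. Lange, Ch. Birkenhake, Complex Abelian Varieties (1992), §1.1, §8.1
  (period matrices `(1 τ)`, the complex structure of `ℂ^g/(ℤ^g ⊕ τℤ^g)` on `ℝ^2g`).
* [FarautKoranyi1994] J. Faraut, A. Korányi, Analysis on Symmetric Cones (1994), Ch. II §6 (the spin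
  factor: `x² = q(x)·e`, inverse `x⁻¹ = (a − X)/(a² − q)`).
-/

noncomputable section

set_option linter.dupNamespace false

namespace Summit.HodgeConjecture.HodgeConjecture.Theorems

open Literature.AlgebraicGeometry.Tropical Literature.AlgebraicGeometry.Tropical.TropicalTorus
open Literature.Geometry.Kaehler
open scoped Matrix

/-! ### §1 The Clifford structure over `ℝ` -/

section Clifford

/-- The successor forms of the family are `B₁(2 + R_l)` (definition of `ksForm`). [folklore] -/
theorem tkc_ksForm_succ (l : Fin 4) : ksForm l.succ = ksBase * (2 + ksClifford l) := rfl

/-- The real forms of the family through the ring homomorphism `M ↦ M.map (ℤ → ℝ)`. [folklore] -/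
theorem tkc_ksForm_map_eq (i : Fin 5) :
    (ksForm i).map (Int.cast : ℤ → ℝ) = (Int.castRingHom ℝ).mapMatrix (ksForm i) := rfl

/-- `B_{l+1} = B₁ (2 + R_l)` over `ℝ`. [folklore] -/
theorem tkc_ksForm_succ_real (l : Fin 4) :
    (ksForm l.succ).map (Int.cast : ℤ → ℝ) =
      ksBase.map (Int.cast : ℤ → ℝ) * (2 + (ksClifford l).map (Int.cast : ℤ → ℝ)) := by
  have h := congrArg (Int.castRingHom ℝ).mapMatrix (tkc_ksForm_succ l)
  rw [map_mul, map_add, map_ofNat] at h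
  exact h

/-- The Clifford squares over `ℝ`: `R_l² = s_l · 1`, `s = (1, 2, 2, 2)`. [folklore] -/
theorem tkc_clifford_sq_real (l : Fin 4) :
    (ksClifford l).map (Int.cast : ℤ → ℝ) * (ksClifford l).map (Int.cast : ℤ → ℝ) =
      (if l = 0 then (1 : ℝ) else 2) • (1 : Matrix (Fin 8) (Fin 8) ℝ) := by
  have h := congrArg (Int.castRingHom ℝ).mapMatrix (ksClifford_sq l)
  rw [map_mul, map_zsmul, map_one] at h
  rw [show (ksClifford l).map (Int.cast : ℤ → ℝ) = (Int.castRingHom ℝ).mapMatrix (ksClifford l) from rfl, h,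
    ← Int.cast_smul_eq_zsmul ℝ]
  congr 1
  push_cast
  split_ifs <;> rfl

/-- The Clifford generators anticommute over `ℝ`. [folklore] -/
theorem tkc_clifford_anticomm_real {l m : Fin 4} (h : l ≠ m) :
    (ksClifford l).map (Int.cast : ℤ → ℝ) * (ksClifford m).map (Int.cast : ℤ → ℝ) =
      -((ksClifford m).map (Int.cast : ℤ → ℝ) * (ksClifford l).map (Int.cast : ℤ → ℝ)) := by
  have h' := congrArg (Int.castRingHom ℝ).mapMatrix (ksClifford_anticomm l m h)
  rw [map_mul, map_neg, map_mul] at h'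
  exact h'

/-- **`X² = q·1`** for `X = Σ_l t_l R_l`, `q = t₀² + 2t₁² + 2t₂² + 2t₃²` (indices of `Fin 4`): the
Clifford relations. [folklore] -/
theorem tkc_X_sq (u : Fin 4 → ℝ) :
    (∑ l, u l • (ksClifford l).map (Int.cast : ℤ → ℝ)) * (∑ l, u l • (ksClifford l).map (Int.cast : ℤ → ℝ)) =
      (∑ l, (if l = 0 then (1 : ℝ) else 2) * u l ^ 2) • (1 : Matrix (Fin 8) (Fin 8) ℝ) := by
  rw [Finset.sum_mul_sum]
  -- symmetrise the double sum
  have hsym : ∑ l, ∑ m, (u l • (ksClifford l).map (Int.cast : ℤ → ℝ)) * (u m • (ksClifford m).map (Int.cast : ℤ → ℝ)) =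
      ∑ l, (u l * u l) • ((ksClifford l).map (Int.cast : ℤ → ℝ) * (ksClifford l).map (Int.cast : ℤ → ℝ)) := by
    have hterm : ∀ l m, (u l • (ksClifford l).map (Int.cast : ℤ → ℝ)) * (u m • (ksClifford m).map (Int.cast : ℤ → ℝ)) =
        (u l * u m) • ((ksClifford l).map (Int.cast : ℤ → ℝ) * (ksClifford m).map (Int.cast : ℤ → ℝ)) := by
      intro l m
      rw [smul_mul_assoc, mul_smul_comm, smul_smul]
    simp_rw [hterm]
    -- 2·(double sum) = double sum + its transpose = diagonal part
    set f : Fin 4 → Fin 4 → Matrix (Fin 8) (Fin 8) ℝ := fun l m =>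
      (u l * u m) • ((ksClifford l).map (Int.cast : ℤ → ℝ) * (ksClifford m).map (Int.cast : ℤ → ℝ)) with hf
    have hcomm : ∑ l, ∑ m, f l m = ∑ l, ∑ m, f m l := Finset.sum_comm
    have h2 : (2 : ℝ) • ∑ l, ∑ m, f l m = (2 : ℝ) • ∑ l, f l l := by
      rw [two_smul, two_smul]
      nth_rewrite 2 [hcomm]
      rw [← Finset.sum_add_distrib, ← Finset.sum_add_distrib]
      refine Finset.sum_congr rfl fun l _ => ?_
      rw [← Finset.sum_add_distrib, Finset.sum_eq_single l]
      · intro m _ hml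
        simp only [hf]
        rw [tkc_clifford_anticomm_real hml, mul_comm (u m) (u l), smul_neg, add_neg_cancel]
      · intro hl; exact absurd (Finset.mem_univ l) hl
    have h2' := congrArg (fun M : Matrix (Fin 8) (Fin 8) ℝ => (2 : ℝ)⁻¹ • M) h2
    simp only [smul_smul] at h2'
    norm_num at h2'
    simpa only [hf] using h2'
  rw [hsym, Finset.sum_smul]
  refine Finset.sum_congr rfl fun l _ => ?_
  rw [tkc_clifford_sq_real, smul_smul]
  congr 1
  ring

end Clifford

/-! ### §1b The family as `B₁(a + X)`, and the inverse formula -/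

section Inverse

/-- **The Clifford presentation of the family**: `B_t = B₁ (a·1 + X)` with `a = t₀ + 2(t₁+…+t₄)` and
`X = Σ_l t_(l+1) R_l`. [folklore] -/
theorem tkc_ksMatrix_eq (t : Fin 5 → ℝ) :
    ksMatrix t = ksBase.map (Int.cast : ℤ → ℝ) * ((t 0 + 2 * ∑ l : Fin 4, t l.succ) • (1 : Matrix (Fin 8) (Fin 8) ℝ) + (∑ l : Fin 4, t l.succ • (ksClifford l).map (Int.cast : ℤ → ℝ))) := by
  rw [ksMatrix, Fin.sum_univ_succ, show ksForm 0 = ksBase from rfl]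
  have h1 : ∀ l : Fin 4, t l.succ • (ksForm l.succ).map (Int.cast : ℤ → ℝ) =
      (2 * t l.succ) • ksBase.map (Int.cast : ℤ → ℝ) +
        t l.succ • (ksBase.map (Int.cast : ℤ → ℝ) * (ksClifford l).map (Int.cast : ℤ → ℝ)) := by
    intro l
    rw [tkc_ksForm_succ_real, Matrix.mul_add, mul_two, smul_add, two_mul, add_smul, smul_add]
  simp_rw [h1]
  rw [Finset.sum_add_distrib, ← Finset.sum_smul, Matrix.mul_add, Matrix.mul_smul, Matrix.mul_one,
    Finset.mul_sum]
  simp only [Finset.mul_sum, Matrix.mul_smul, add_smul, Finset.sum_smul]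
  abel

/-- `B₁ · B₁⁻¹ = 1` for the explicit diagonal inverse. [folklore] -/
theorem tkc_ksBase_mul_cinv : ksBase.map (Int.cast : ℤ → ℝ) * (Matrix.diagonal fun i : Fin 8 => ((((![2, 4, 4, 8, 4, 8, 8, 16] : Fin 8 → ℤ) i : ℝ))⁻¹)) = 1 := by
  rw [ktks_ksBase_map_real, Matrix.diagonal_mul_diagonal, ← Matrix.diagonal_one]
  congr 1
  funext i
  exact mul_inv_cancel₀ (ktks_diag_pos i).ne'

/-- `B₁⁻¹ · B₁ = 1` for the explicit diagonal inverse. [folklore] -/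
theorem tkc_cinv_mul_ksBase : (Matrix.diagonal fun i : Fin 8 => ((((![2, 4, 4, 8, 4, 8, 8, 16] : Fin 8 → ℤ) i : ℝ))⁻¹)) * ksBase.map (Int.cast : ℤ → ℝ) = 1 := by
  rw [ktks_ksBase_map_real, Matrix.diagonal_mul_diagonal, ← Matrix.diagonal_one]
  congr 1
  funext i
  exact inv_mul_cancel₀ (ktks_diag_pos i).ne'

/-- **The inverse formula (numerator)**: `B_t · ((a·1 − X) B₁⁻¹) = (a² − q)·1`,
`q = t₁² + 2t₂² + 2t₃² + 2t₄²` (`(a + X)(a − X) = a² − X² = a² − q`). [folklore] -/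
theorem tkc_ksMatrix_mul_Q (t : Fin 5 → ℝ) :
    ksMatrix t * (((t 0 + 2 * ∑ l : Fin 4, t l.succ) • (1 : Matrix (Fin 8) (Fin 8) ℝ) - (∑ l : Fin 4, t l.succ • (ksClifford l).map (Int.cast : ℤ → ℝ))) * (Matrix.diagonal fun i : Fin 8 => ((((![2, 4, 4, 8, 4, 8, 8, 16] : Fin 8 → ℤ) i : ℝ))⁻¹))) =
      ((t 0 + 2 * ∑ l : Fin 4, t l.succ) ^ 2 - (∑ l : Fin 4, (if l = 0 then (1 : ℝ) else 2) * t l.succ ^ 2)) • (1 : Matrix (Fin 8) (Fin 8) ℝ) := by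
  rw [tkc_ksMatrix_eq, Matrix.mul_assoc, ← Matrix.mul_assoc ((t 0 + 2 * ∑ l : Fin 4, t l.succ) • (1 : Matrix (Fin 8) (Fin 8) ℝ) + (∑ l : Fin 4, t l.succ • (ksClifford l).map (Int.cast : ℤ → ℝ)))]
  have hprod : ((t 0 + 2 * ∑ l : Fin 4, t l.succ) • (1 : Matrix (Fin 8) (Fin 8) ℝ) + (∑ l : Fin 4, t l.succ • (ksClifford l).map (Int.cast : ℤ → ℝ))) * ((t 0 + 2 * ∑ l : Fin 4, t l.succ) • (1 : Matrix (Fin 8) (Fin 8) ℝ) - (∑ l : Fin 4, t l.succ • (ksClifford l).map (Int.cast : ℤ → ℝ))) =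
      ((t 0 + 2 * ∑ l : Fin 4, t l.succ) ^ 2 - (∑ l : Fin 4, (if l = 0 then (1 : ℝ) else 2) * t l.succ ^ 2)) • (1 : Matrix (Fin 8) (Fin 8) ℝ) := by
    rw [add_mul, mul_sub, mul_sub, tkc_X_sq, smul_mul_assoc, one_mul, smul_mul_assoc, one_mul,
      mul_smul_comm, mul_one, smul_smul, sub_smul, pow_two]
    abel
  rw [hprod, smul_mul_assoc, Matrix.one_mul, Matrix.mul_smul, tkc_ksBase_mul_cinv]

/-- **The numerator lies in the span of the `C_j = B₁⁻¹ B_j B₁⁻¹`**: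
`(a·1 − X) B₁⁻¹ = (t₀ + 4σ) B₁⁻¹ − Σ_l t_(l+1) B₁⁻¹ B_(l+1) B₁⁻¹`, `σ = t₁ + … + t₄`. [folklore] -/
theorem tkc_Q_eq_span (t : Fin 5 → ℝ) :
    ((t 0 + 2 * ∑ l : Fin 4, t l.succ) • (1 : Matrix (Fin 8) (Fin 8) ℝ) - (∑ l : Fin 4, t l.succ • (ksClifford l).map (Int.cast : ℤ → ℝ))) * (Matrix.diagonal fun i : Fin 8 => ((((![2, 4, 4, 8, 4, 8, 8, 16] : Fin 8 → ℤ) i : ℝ))⁻¹)) =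
      (t 0 + 4 * ∑ l : Fin 4, t l.succ) • (Matrix.diagonal fun i : Fin 8 => ((((![2, 4, 4, 8, 4, 8, 8, 16] : Fin 8 → ℤ) i : ℝ))⁻¹)) -
        ∑ l : Fin 4, t l.succ • ((Matrix.diagonal fun i : Fin 8 => ((((![2, 4, 4, 8, 4, 8, 8, 16] : Fin 8 → ℤ) i : ℝ))⁻¹)) * (ksForm l.succ).map (Int.cast : ℤ → ℝ) * (Matrix.diagonal fun i : Fin 8 => ((((![2, 4, 4, 8, 4, 8, 8, 16] : Fin 8 → ℤ) i : ℝ))⁻¹))) := by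
  have hC : ∀ l : Fin 4, (Matrix.diagonal fun i : Fin 8 => ((((![2, 4, 4, 8, 4, 8, 8, 16] : Fin 8 → ℤ) i : ℝ))⁻¹)) * (ksForm l.succ).map (Int.cast : ℤ → ℝ) * (Matrix.diagonal fun i : Fin 8 => ((((![2, 4, 4, 8, 4, 8, 8, 16] : Fin 8 → ℤ) i : ℝ))⁻¹)) =
      (2 : ℝ) • (Matrix.diagonal fun i : Fin 8 => ((((![2, 4, 4, 8, 4, 8, 8, 16] : Fin 8 → ℤ) i : ℝ))⁻¹)) + (ksClifford l).map (Int.cast : ℤ → ℝ) * (Matrix.diagonal fun i : Fin 8 => ((((![2, 4, 4, 8, 4, 8, 8, 16] : Fin 8 → ℤ) i : ℝ))⁻¹)) := by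
    intro l
    rw [tkc_ksForm_succ_real, ← Matrix.mul_assoc, tkc_cinv_mul_ksBase, Matrix.one_mul, add_mul,
      two_mul, two_smul]
  simp_rw [hC, smul_add, Finset.sum_add_distrib, sub_mul, smul_mul_assoc, one_mul, Finset.sum_mul,
    smul_mul_assoc, smul_smul]
  rw [← Finset.sum_smul, ← Finset.sum_mul]
  module

end Inverse

/-! ### §1c On the positive cone: `a² ≠ q` and the inverse formula -/

section Cone

/-- The Clifford generators are traceless. [folklore] -/
theorem tkc_trace_clifford (l : Fin 4) : Matrix.trace ((ksClifford l).map (Int.cast : ℤ → ℝ)) = 0 := by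
  have h : Matrix.trace (ksClifford l) = 0 := by
    fin_cases l <;> decide
  have h' : Matrix.trace ((ksClifford l).map (Int.cast : ℤ → ℝ)) = ((Matrix.trace (ksClifford l) : ℤ) : ℝ) := by
    simp [Matrix.trace, Matrix.diag]
  rw [h', h, Int.cast_zero]

/-- **On the positive cone `a² ≠ q`** (else `B_t (a − X) B₁⁻¹ = 0` with `B_t` invertible forces
`X = a·1`, whose trace gives `a = 0`, `X = 0`, `B_t = 0`). [folklore] -/
theorem tkc_sq_sub_q_ne_zero (t : Fin 5 → ℝ) (ht : t ∈ ksPosCone) :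
    (t 0 + 2 * ∑ l : Fin 4, t l.succ) ^ 2 - (∑ l : Fin 4, (if l = 0 then (1 : ℝ) else 2) * t l.succ ^ 2) ≠ 0 := by
  intro h0
  have hpd : (ksMatrix t).PosDef := ht
  have hdet : (ksMatrix t).det ≠ 0 := hpd.det_pos.ne'
  have hunit : IsUnit (ksMatrix t).det := isUnit_iff_ne_zero.2 hdet
  have hS := tkc_ksMatrix_mul_Q t
  rw [h0, zero_smul] at hS
  have hQ0 : ((t 0 + 2 * ∑ l : Fin 4, t l.succ) • (1 : Matrix (Fin 8) (Fin 8) ℝ) - (∑ l : Fin 4, t l.succ • (ksClifford l).map (Int.cast : ℤ → ℝ))) * (Matrix.diagonal fun i : Fin 8 => ((((![2, 4, 4, 8, 4, 8, 8, 16] : Fin 8 → ℤ) i : ℝ))⁻¹)) = 0 := by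
    have h1 := congrArg (fun M => (ksMatrix t)⁻¹ * M) hS
    simp only [← Matrix.mul_assoc, Matrix.nonsing_inv_mul _ hunit, Matrix.one_mul, Matrix.mul_zero] at h1
    exact h1
  have hX : (t 0 + 2 * ∑ l : Fin 4, t l.succ) • (1 : Matrix (Fin 8) (Fin 8) ℝ) - (∑ l : Fin 4, t l.succ • (ksClifford l).map (Int.cast : ℤ → ℝ)) = 0 := by
    have h1 := congrArg (fun M => M * ksBase.map (Int.cast : ℤ → ℝ)) hQ0
    simp only [Matrix.mul_assoc, tkc_cinv_mul_ksBase, Matrix.mul_one, Matrix.zero_mul] at h1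
    exact h1
  have htrX : Matrix.trace (∑ l : Fin 4, t l.succ • (ksClifford l).map (Int.cast : ℤ → ℝ)) = 0 := by
    rw [Matrix.trace_sum]
    refine Finset.sum_eq_zero fun l _ => ?_
    rw [Matrix.trace_smul, tkc_trace_clifford, smul_zero]
  have htr := congrArg Matrix.trace hX
  rw [Matrix.trace_sub, Matrix.trace_smul, Matrix.trace_one, Fintype.card_fin, htrX, sub_zero,
    Matrix.trace_zero, smul_eq_mul] at htr
  have hA : (t 0 + 2 * ∑ l : Fin 4, t l.succ) = 0 := by
    have : (t 0 + 2 * ∑ l : Fin 4, t l.succ) * (8 : ℝ) = 0 := by exact_mod_cast htr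
    simpa using this
  have hX0 : (∑ l : Fin 4, t l.succ • (ksClifford l).map (Int.cast : ℤ → ℝ)) = 0 := by
    rw [hA, zero_smul, zero_sub, neg_eq_zero] at hX
    exact hX
  have hS0 : ksMatrix t = 0 := by
    rw [tkc_ksMatrix_eq, hA, hX0, zero_smul, add_zero, Matrix.mul_zero]
  rw [hS0, Matrix.det_zero] at hdet
  exact hdet rfl

/-- **The inverse formula**: on the positive cone
`B_t⁻¹ = (a² − q)⁻¹ · (a·1 − X) B₁⁻¹`. [folklore] -/
theorem tkc_ksMatrix_inv (t : Fin 5 → ℝ) (ht : t ∈ ksPosCone) :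
    (ksMatrix t)⁻¹ = ((t 0 + 2 * ∑ l : Fin 4, t l.succ) ^ 2 - (∑ l : Fin 4, (if l = 0 then (1 : ℝ) else 2) * t l.succ ^ 2))⁻¹ • (((t 0 + 2 * ∑ l : Fin 4, t l.succ) • (1 : Matrix (Fin 8) (Fin 8) ℝ) - (∑ l : Fin 4, t l.succ • (ksClifford l).map (Int.cast : ℤ → ℝ))) * (Matrix.diagonal fun i : Fin 8 => ((((![2, 4, 4, 8, 4, 8, 8, 16] : Fin 8 → ℤ) i : ℝ))⁻¹))) := by
  apply Matrix.inv_eq_right_inv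
  rw [Matrix.mul_smul, tkc_ksMatrix_mul_Q, smul_smul, inv_mul_cancel₀ (tkc_sq_sub_q_ne_zero t ht),
    one_smul]

/-- **`B_t⁻¹` lies in the span of the `C_j = B₁⁻¹ B_j B₁⁻¹`** (`C₀ = B₁⁻¹`): explicitly
`B_t⁻¹ = Σ_j u_j C_j` with `u₀ = (t₀ + 4σ)/(a² − q)`, `u_j = −t_j/(a² − q)`. [folklore] -/
theorem tkc_ksMatrix_inv_mem_span (t : Fin 5 → ℝ) (ht : t ∈ ksPosCone) :
    ∃ u : Fin 5 → ℝ, (ksMatrix t)⁻¹ =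
      ∑ j : Fin 5, u j • ((Matrix.diagonal fun i : Fin 8 => ((((![2, 4, 4, 8, 4, 8, 8, 16] : Fin 8 → ℤ) i : ℝ))⁻¹)) * (ksForm j).map (Int.cast : ℤ → ℝ) * (Matrix.diagonal fun i : Fin 8 => ((((![2, 4, 4, 8, 4, 8, 8, 16] : Fin 8 → ℤ) i : ℝ))⁻¹))) := by
  refine ⟨Fin.cases (((t 0 + 2 * ∑ l : Fin 4, t l.succ) ^ 2 - (∑ l : Fin 4, (if l = 0 then (1 : ℝ) else 2) * t l.succ ^ 2))⁻¹ * (t 0 + 4 * ∑ l : Fin 4, t l.succ))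
    (fun l => -(((t 0 + 2 * ∑ l : Fin 4, t l.succ) ^ 2 - (∑ l : Fin 4, (if l = 0 then (1 : ℝ) else 2) * t l.succ ^ 2))⁻¹ * t l.succ)), ?_⟩
  rw [tkc_ksMatrix_inv t ht, tkc_Q_eq_span, Fin.sum_univ_succ (n := 4)]
  simp only [Fin.cases_zero, Fin.cases_succ]
  rw [show ksForm 0 = ksBase from rfl, tkc_cinv_mul_ksBase, Matrix.one_mul, smul_sub, smul_smul,
    Finset.smul_sum]
  simp only [smul_smul, neg_smul, Finset.sum_neg_distrib, sub_eq_add_neg]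

end Cone

/-! ### §2 The period map and the complex structure of a member -/

section Period

/-- **The Kuga–Satake period map in real coordinates**: `Φ(x, y) = (x + R y) + i (S y)` with
`R = B_(Re z)`, `S = B_(Im z)`. [cite: LangeBirkenhake1992, §8.1] -/
theorem tkc_period_apply {z : Fin 5 → ℂ} {Φ : (Fin 8 ⊕ Fin 8 → ℝ) ≃L[ℝ] (Fin 8 → ℂ)}
    (hΦ : IsKSPeriodMap z Φ) (w : Fin 8 ⊕ Fin 8 → ℝ) (i : Fin 8) :
    Φ w i = (((w (Sum.inl i) + (ksMatrix (fun k => (z k).re) *ᵥ (fun j => w (Sum.inr j))) i : ℝ)) : ℂ) +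
      (((ksMatrix (fun k => (z k).im) *ᵥ (fun j => w (Sum.inr j))) i : ℝ) : ℂ) * Complex.I := by
  rw [hΦ w]
  simp only [ksPeriod_apply, ksMatrix_apply, Matrix.mulVec, dotProduct]
  apply Complex.ext
  · simp [Complex.re_sum, Finset.sum_mul]
  · simp [Complex.im_sum, Finset.sum_mul]

/-- **Real and imaginary parts commute with the real-linear inverse period map**:
`Φ⁻¹((a + bi) v) = a Φ⁻¹(v) + b Φ⁻¹(i v)`; in particular the rotation by `e^(iθ)` reads
`Φ⁻¹(e^(iθ) Φ w) = cos θ · w + sin θ · Φ⁻¹(i Φ w)`. [cite: LangeBirkenhake1992, §1.1] -/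
theorem tkc_symm_exp_smul_eq (Φ : (Fin 8 ⊕ Fin 8 → ℝ) ≃L[ℝ] (Fin 8 → ℂ)) (θ : ℝ) (w : Fin 8 ⊕ Fin 8 → ℝ) :
    Φ.symm (Complex.exp (θ * Complex.I) • Φ w) =
      Real.cos θ • w + Real.sin θ • Φ.symm (Complex.I • Φ w) := by
  have hexp : Complex.exp (θ * Complex.I) • Φ w =
      (Real.cos θ : ℝ) • Φ w + (Real.sin θ : ℝ) • (Complex.I • Φ w) := by
    funext i
    simp only [Pi.smul_apply, Pi.add_apply, smul_eq_mul, Complex.real_smul, Complex.exp_mul_I,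
      Complex.ofReal_cos, Complex.ofReal_sin]
    ring
  rw [hexp, map_add, map_smul, map_smul, ContinuousLinearEquiv.symm_apply_apply]

/-- **The complex structure of the member `z` in real coordinates**:
`J_z = Φ⁻¹ ∘ i ∘ Φ` is `(x, y) ↦ (−S y − R S⁻¹(x + R y), S⁻¹(x + R y))` (`R = B_(Re z)`, `S = B_(Im z)`
invertible on the tube domain). [cite: LangeBirkenhake1992, §1.1 and §8.1] -/
theorem tkc_J_apply {z : Fin 5 → ℂ} {Φ : (Fin 8 ⊕ Fin 8 → ℝ) ≃L[ℝ] (Fin 8 → ℂ)}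
    (hΦ : IsKSPeriodMap z Φ) (hz : (fun k => (z k).im) ∈ ksPosCone) (w : Fin 8 ⊕ Fin 8 → ℝ) :
    Φ.symm (Complex.I • Φ w) =
      Sum.elim (-(ksMatrix (fun k => (z k).im) *ᵥ (fun j => w (Sum.inr j))) -
          ksMatrix (fun k => (z k).re) *ᵥ ((ksMatrix (fun k => (z k).im))⁻¹ *ᵥ ((fun i => w (Sum.inl i)) + ksMatrix (fun k => (z k).re) *ᵥ (fun j => w (Sum.inr j)))))
        ((ksMatrix (fun k => (z k).im))⁻¹ *ᵥ ((fun i => w (Sum.inl i)) + ksMatrix (fun k => (z k).re) *ᵥ (fun j => w (Sum.inr j)))) := by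
  have hpd : (ksMatrix (fun k => (z k).im)).PosDef := hz
  have hunit : IsUnit (ksMatrix (fun k => (z k).im)).det := isUnit_iff_ne_zero.2 hpd.det_pos.ne'
  rw [ContinuousLinearEquiv.symm_apply_eq]
  funext i
  rw [Pi.smul_apply, tkc_period_apply hΦ, tkc_period_apply hΦ]
  simp only [Sum.elim_inl, Sum.elim_inr]
  have hSS : ksMatrix (fun k => (z k).im) *ᵥ ((ksMatrix (fun k => (z k).im))⁻¹ *ᵥ ((fun i => w (Sum.inl i)) + ksMatrix (fun k => (z k).re) *ᵥ (fun j => w (Sum.inr j)))) =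
      (fun i => w (Sum.inl i)) + ksMatrix (fun k => (z k).re) *ᵥ (fun j => w (Sum.inr j)) := by
    rw [Matrix.mulVec_mulVec, Matrix.mul_nonsing_inv _ hunit, Matrix.one_mulVec]
  simp only [hSS]
  apply Complex.ext
  · simp
  · simp

end Period

end Summit.HodgeConjecture.HodgeConjecture.Theorems

end
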